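import Summits.QuantumFields.BalabanUV.T4Continuum.Support.NE3FramePotBoundW
import Summits.QuantumFields.BalabanUV.T4Continuum.Support.BlockAverageDbarLinNorms
import Summits.QuantumFields.BalabanUV.T4Continuum.Support.NE3TopRadiusLetters
import HarnessLib

/-!
# T⁴ programme, node NE3, route Π item Π-C (file Π-C-1) — THE SUP LETTER OF THE LINEARISED k-FOLD AVERAGE:
# `‖dirIter L k W Y‖_∞ ≤ (3 + 12d)·L^k·‖Y‖_∞`, k-FREE, at a small-field background in the tower class

NE3 formalisation swarm `b2b-balaban-t4-ne3-formalise-*`, LEAF PROVER 02 (gen 7); route Π of the owner's design note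
`HOME/t4/b2b-balaban-t4-ne3-p1/g24/D-ne3p1-g24-1.md` §6 row Π-C + §8 (iv′); SHAPE `HOME/t4/b2b-balaban-t4-ne3-formalise-leaf-02/g7/PI-C-SHAPE-leaf02g7.md`;
INTENT HOME/CLAIMS.log l.22318.  The LINEAR input of the k-fold quadratic-remainder estimate (file Π-C-3): the sup→sup size of leaf-04's
linearised k-fold average `NE3TangentCovariantTower.dirIter`, uniformly in the number of levels.  By the structure theorem
`dirIter_eq_QbarIter_add_gaugeDir` (BY NAME) it is the straight double-bar tower `QbarIter` — one step has sup norm `≤ L + curv` by leaf-10's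
`BlockAverageDbarLinNorms.norm_dbarLin_le_sup`, `curv = CQ·16(d+1)(d+4)L²a` the curvature letter of the level, so the tower costs
`L^k·Π_i(1 + curv_i∕L) ≤ 3·L^k` under ONE summed curvature line — plus the coarse gauge direction of the accumulated frames `framePotW` (closed
form `NE3FramePotBoundW.framePotW_eq_sum`; one frame `≤ d·L·sup`, geometric sum `≤ 6d·L^k`, gauge direction `≤ 2·sup`).  [Balaban1985Averaging]
(126)∕(130)–(131)∕(139)–(143) TYPE on OUR frame (our `cpush` keeps the frame part `gaugeDir∘Fbar` — whence the honest `12d`).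

CONTENT (all [folklore]; 0 sorry; two real-valued DATA defs `curv`, `curvSum` by explicit formula): §0 the curvature letters; §1 `lnorm_le_length_mul`,
`norm_Fbar_le_sup` (`≤ (d·L)·s`), `norm_gaugeDir_le_sup` (`≤ 2t`), `norm_Qbar_le_sup` (`≤ (L + curv d L a)·s`); §2 `levelSmall_shift`, `levelData`;
§3 **`norm_QbarIter_le_sup`** (`≤ 3·L^{j+1}·s` under `curvSum d L (j+1) x ≤ (2∕3)·L`); §4 **`norm_framePotW_le_sup`** (`≤ 6d·L^{j+1}·s`, `2 ≤ L`);
§5 **`norm_dirIter_le_sup`** (`≤ (3 + 12d)·L^{j+1}·s`); §6 the curvature line in the θ-letter (`curvSum_le_of_levelSmall`: `≤ (17∕12)·curv d L ((L²)^j·x)` under `LevelSmall`).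

HONEST FRAMING.  Lattice kinematics of the linearised averaging map on OUR frame; nothing about Bałaban's minimisers; the quadratic remainder (Π-C-3),
`DecomposedRep`'s sizes, (P♮)_W (K6's), T-E_w♯ and NE3 are NOT proved here; spine PROVED 0∕9; finite T⁴ rung (B)+1 — NOT infinite volume, NOT mass
gap, NOT BetaPertH, NOT Clay.  ABSOLUTE RULE kept (no printed sentence is a hypothesis; context only: [Balaban1985Averaging] (42) p. 23, (120)–(126)
pp. 35–36, (139)–(143) p. 39).  PLACEMENT: `Summits/QuantumFields/BalabanUV/`.  HONEST DEPENDENCY: continuum YM on T⁴ ⇐ BetaPertH ∧ nine spine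
estimates (0/9 proved); BetaPertH ⇐ (D1) ∧ (D4) ∧ CAP+tail; G-an2-4 gates asym, D1 and NE2/3/4.
-/

set_option autoImplicit false

open scoped BigOperators Matrix.Norms.L2Operator
open Finset

namespace Summit.QuantumFields.BalabanUV.T4Continuum.NE3LinearisedAverageSup

open Literature.MathematicalPhysics.QuantumFieldTheory.Balaban1983to89
open B7Prop1Explicit B7Prop2Explicit
open T4AveragingDeficitWall (IsUnitaryCfg IsSkewDir SmallField Ad)
open T4AveragingDeficitWallBoundary (IsPeriodicCfg)
open AveragingDeficitPeriodicCounting (IsPeriodicDir)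
open AveragingDeficitTransport (lnorm lnorm_nil lnorm_cons norm_dhol_le norm_Ad_of_unitary)
open AveragingDeficitChartCalculus (cavg)
open AveragingDeficitTwoLevelPrep (twoLevelSmall prop1Radius)
open AveragingDeficitMultiLevelPrep (cavgIter radIter tower LevelSmall cavgIter_unitary_small)
open BlockAveragePushDirGauge (gaugeDir)
open BlockAveragePushDirSplit (frameLin sum_blockWeight_eq_one)
open BlockAverageVaryHolo (nbRad U1_of_isUnitaryCfg)
open BlockAverageDbarLinNorms (norm_dbarLin_le_sup)
open NE3TangentCovariantStructure (Qbar Fbar)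
open NE3TangentCovariantTower (dirIter QbarIter framePotW dirIter_eq_QbarIter_add_gaugeDir QbarIter_succ QbarIter_zero QbarIter_one
  step_small)
open NE3FramePotBoundW (framePotW_eq_sum levelSmall_of_le levelSmall_pred)
open NE3TopRadiusLetters (radIter_eq_iterate iterate_prop1Radius_le_of_levelSmall)

noncomputable section
variable {d : ℕ} {n : Type*} [Fintype n] [DecidableEq n]


/-! ## §0 The curvature letters -/
/-- THE ONE-STEP CURVATURE LETTER `curv d L a := CQ(d,L)·(16(d+1)(d+4)L²·a)`, `CQ = 1250(nbRad+L) + 8dL + 2L`: the excess of the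
sup→sup norm of the linearised double-bar average over `L` at a background of plaquette radius `a` (leaf-10's `norm_dbarLin_le_sup`
with B7's loop-variable radius `w = 16(d+1)(d+4)L²a`). [folklore] -/
def curv (d L : ℕ) (a : ℝ) : ℝ :=
  (1250 * ((nbRad d L : ℝ) + L) + 8 * ((d : ℝ) * L) + 2 * L) * (16 * ((d : ℝ) + 1) * ((d : ℝ) + 4) * (L : ℝ) ^ 2 * a)

/-- THE SUMMED CURVATURE LETTER of `m` levels: `curvSum d L m x := Σ_{i<m} curv d L (radIter d L i x)`. [folklore] -/
def curvSum (d L : ℕ) (m : ℕ) (x : ℝ) : ℝ := ∑ i ∈ range m, curv d L (radIter d L i x)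

omit [Fintype n] [DecidableEq n] in
/-- `curv ≥ 0` for `a ≥ 0`. [folklore] -/
theorem curv_nonneg (L : ℕ) {a : ℝ} (ha : 0 ≤ a) : 0 ≤ curv d L a := by unfold curv; positivity

omit [Fintype n] [DecidableEq n] in
/-- `curv` is monotone and linear in the radius: `curv d L a ≤ curv d L b` for `a ≤ b`. [folklore] -/
theorem curv_mono (L : ℕ) {a b : ℝ} (hab : a ≤ b) : curv d L a ≤ curv d L b := by
  unfold curv
  have h0 : 0 ≤ (1250 * ((nbRad d L : ℝ) + L) + 8 * ((d : ℝ) * L) + 2 * L) * (16 * ((d : ℝ) + 1) * ((d : ℝ) + 4) * (L : ℝ) ^ 2) := by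
    positivity
  nlinarith

omit [Fintype n] [DecidableEq n] in
/-- `curv d L (c·a) = c·curv d L a`. [folklore] -/
theorem curv_mul (L : ℕ) (c a : ℝ) : curv d L (c * a) = c * curv d L a := by unfold curv; ring

omit [Fintype n] [DecidableEq n] in
/-- `radIter ≥ 0` for `x ≥ 0`. [folklore] -/
theorem radIter_nonneg (L : ℕ) : ∀ (i : ℕ) {x : ℝ}, 0 ≤ x → 0 ≤ radIter d L i x
  | 0, _, hx => hx
  | i + 1, _, hx => radIter_nonneg L i (by unfold prop1Radius; positivity)

omit [Fintype n] [DecidableEq n] in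
/-- `curvSum ≥ 0` for `x ≥ 0`. [folklore] -/
theorem curvSum_nonneg (L m : ℕ) {x : ℝ} (hx : 0 ≤ x) : 0 ≤ curvSum d L m x :=
  Finset.sum_nonneg fun i _ => curv_nonneg L (radIter_nonneg L i hx)

omit [Fintype n] [DecidableEq n] in
/-- `curvSum` is monotone in the number of levels (`x ≥ 0`). [folklore] -/
theorem curvSum_mono (L : ℕ) {m m' : ℕ} (h : m ≤ m') {x : ℝ} (hx : 0 ≤ x) : curvSum d L m x ≤ curvSum d L m' x :=
  Finset.sum_le_sum_of_subset_of_nonneg (Finset.range_mono h) fun i _ _ => curv_nonneg L (radIter_nonneg L i hx)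

omit [Fintype n] [DecidableEq n] in
/-- The inner-first shift of the summed letter: `curvSum d L (m+1) x = curv d L x + curvSum d L m (prop1Radius d L x)`. [folklore] -/
theorem curvSum_succ (L m : ℕ) (x : ℝ) : curvSum d L (m + 1) x = curv d L x + curvSum d L m (prop1Radius d L x) := by
  unfold curvSum
  rw [Finset.sum_range_succ', add_comm]
  rfl

/-! ## §1 Elementary sup letters -/
/-- `lnorm ψ q w ≤ |w|·s` when `‖ψ b‖ ≤ s` everywhere. [folklore] -/
theorem lnorm_le_length_mul (ψ : Site d → Fin d → (Matrix n n ℂ)) {s : ℝ} (hψ : ∀ (x : Site d) (μ : Fin d), ‖ψ x μ‖ ≤ s) :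
    ∀ (q : Site d) (w : List (Letter d)), lnorm ψ q w ≤ (w.length : ℝ) * s
  | q, [] => by simp
  | q, l :: w => by
      rw [lnorm_cons, List.length_cons]
      push_cast
      have h1 := hψ (if l.2 then q else q + l.vec) l.1
      have h2 := lnorm_le_length_mul ψ hψ (q + l.vec) w
      linarith

/-- **ONE LINEARISED FRAME IN SUP**: `‖Fbar L U Y y‖ ≤ (d·L)·s` at any unitary `U` (every tree contour has at most `dL` bonds, the
transports are isometries, the block weights sum to one). [folklore] -/
theorem norm_Fbar_le_sup {L : ℕ} (hL : 1 ≤ L) {U : Site d → Fin d → (Matrix n n ℂ)ˣ} (hU : IsUnitaryCfg U) (Y : Site d → Fin d → (Matrix n n ℂ))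
    {s : ℝ} (hs : 0 ≤ s) (hY : ∀ (x : Site d) (μ : Fin d), ‖Y x μ‖ ≤ s) (y : Site d) :
    ‖Fbar L U Y y‖ ≤ ((d : ℝ) * L) * s := by
  show ‖frameLin L U Y ((L : ℤ) • y)‖ ≤ _
  unfold frameLin
  have hwt := sum_blockWeight_eq_one (d := d) L hL
  calc ‖∑ r : Fin d → Fin L, (((L : ℝ) ^ d)⁻¹) • AveragingDeficitTransport.dhol U Y ((L : ℤ) • y) (treeWord (boxVec L r))‖
      ≤ ∑ r : Fin d → Fin L, ‖(((L : ℝ) ^ d)⁻¹) • AveragingDeficitTransport.dhol U Y ((L : ℤ) • y) (treeWord (boxVec L r))‖ :=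
        norm_sum_le _ _
    _ ≤ ∑ _r : Fin d → Fin L, ((L : ℝ) ^ d)⁻¹ * (((d : ℝ) * L) * s) := by
        refine Finset.sum_le_sum fun r _ => ?_
        rw [norm_smul, Real.norm_eq_abs, abs_of_nonneg (by positivity)]
        refine mul_le_mul_of_nonneg_left ?_ (by positivity)
        refine (norm_dhol_le hU Y _ _).trans ((lnorm_le_length_mul Y hY _ _).trans ?_)
        rw [length_treeWord]
        exact mul_le_mul_of_nonneg_right (by exact_mod_cast l1_boxVec_le (L := L) r) hs
    _ = ((d : ℝ) * L) * s := by rw [← Finset.sum_mul, hwt]; ring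

/-- **A GAUGE DIRECTION IN SUP**: `‖gaugeDir U f z κ‖ ≤ 2t` when `‖f‖ ≤ t` everywhere and `U` is unitary. [folklore] -/
theorem norm_gaugeDir_le_sup {U : Site d → Fin d → (Matrix n n ℂ)ˣ} (hU : IsUnitaryCfg U) {f : Site d → (Matrix n n ℂ)} {t : ℝ}
    (hf : ∀ z : Site d, ‖f z‖ ≤ t) (z : Site d) (κ : Fin d) : ‖gaugeDir U f z κ‖ ≤ 2 * t := by
  unfold gaugeDir
  have hu : (U z κ)⁻¹ ∈ unitaryUnits (Matrix n n ℂ) := (unitaryUnits (Matrix n n ℂ)).inv_mem (hU z κ)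
  calc ‖Ad (U z κ)⁻¹ (f z) - f (z + e κ)‖ ≤ ‖Ad (U z κ)⁻¹ (f z)‖ + ‖f (z + e κ)‖ := norm_sub_le _ _
    _ = ‖f z‖ + ‖f (z + e κ)‖ := by rw [norm_Ad_of_unitary hu]
    _ ≤ 2 * t := by linarith [hf z, hf (z + e κ)]

/-- The loop variables of (42) at a background of plaquette radius `a` with `512(d+1)(d+4)L²a ≤ 1` are within the curvature
radius `w = 16(d+1)(d+4)L²a ≤ 1∕32` of `1` (B7's `norm_Wcx_sub_one_le` BY NAME). [folklore] -/
theorem norm_Wcx_sub_one_le_w [Nonempty n] {L : ℕ} (hL : 1 ≤ L) {W : Site d → Fin d → (Matrix n n ℂ)ˣ} (hWu : IsUnitaryCfg W)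
    {a : ℝ} (ha : 0 ≤ a) (hsmall : 512 * (d + 1) * (d + 4) * (L : ℝ) ^ 2 * a ≤ 1) (hWa : SmallField W a)
    (q : Site d) (κ : Fin d) (r : Fin d → Fin L) :
    ‖((Wcx L W q κ (boxVec L r) : (Matrix n n ℂ)ˣ) : (Matrix n n ℂ)) - 1‖ ≤ 16 * ((d : ℝ) + 1) * ((d : ℝ) + 4) * (L : ℝ) ^ 2 * a := by
  have h := norm_Wcx_sub_one_le L hL W (U1_of_isUnitaryCfg hWu) ha hsmall hWa q κ r
  refine h.trans (le_of_eq ?_)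
  ring

/-- **ONE STEP OF THE DOUBLE-BAR AVERAGE IN SUP**: `‖Qbar L W Y z κ‖ ≤ (L + curv d L a)·s` for `‖Y‖ ≤ s` everywhere, at a unitary
background of plaquette radius `a`, `512(d+1)(d+4)L²a ≤ 1` (leaf-10's `norm_dbarLin_le_sup` read at the block corner `L•z`). [folklore] -/
theorem norm_Qbar_le_sup [Nonempty n] {L : ℕ} (hL : 1 ≤ L) {W : Site d → Fin d → (Matrix n n ℂ)ˣ} (hWu : IsUnitaryCfg W)
    {a : ℝ} (ha : 0 ≤ a) (hsmall : 512 * (d + 1) * (d + 4) * (L : ℝ) ^ 2 * a ≤ 1) (hWa : SmallField W a)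
    (Y : Site d → Fin d → (Matrix n n ℂ)) {s : ℝ} (hY : ∀ (x : Site d) (μ : Fin d), ‖Y x μ‖ ≤ s) (z : Site d) (κ : Fin d) :
    ‖Qbar L W Y z κ‖ ≤ ((L : ℝ) + curv d L a) * s := by
  have hw : 16 * ((d : ℝ) + 1) * ((d : ℝ) + 4) * (L : ℝ) ^ 2 * a ≤ 1 / 32 := by
    have h0 : 0 ≤ ((d : ℝ) + 1) * ((d : ℝ) + 4) * (L : ℝ) ^ 2 * a := by positivity
    nlinarith
  have h := norm_dbarLin_le_sup L hL hWu Y ((L : ℤ) • z) κ hw (fun r => norm_Wcx_sub_one_le_w hL hWu ha hsmall hWa _ κ r)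
    (s := s) (fun x μ _ => hY x μ)
  show ‖BlockAveragePushDirSplit.dbarLin L W Y ((L : ℤ) • z) κ‖ ≤ _
  refine h.trans (le_of_eq ?_)
  unfold curv
  ring

/-! ## §2 Tower bookkeeping -/
omit [Fintype n] [DecidableEq n] in
/-- `LevelSmall` shifts along the tower: `LevelSmall d L (m + i) x → LevelSmall d L i (radIter d L m x)`. [folklore] -/
theorem levelSmall_shift {L : ℕ} : ∀ (m : ℕ) {i : ℕ} {x : ℝ}, LevelSmall d L (m + i) x → LevelSmall d L i (radIter d L m x)
  | 0, i, x, h => by rw [Nat.zero_add] at h; exact h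
  | m + 1, i, x, h => by
      rw [show m + 1 + i = (m + i) + 1 by omega] at h
      exact levelSmall_shift m h.2

/-- **LEVEL DATA**: in the tower class (`W` unitary, `0 ≤ x`, `LevelSmall d L j x`, `SmallField W x`) the level-`m` background
`cavgIter L m W`, `m ≤ j + 1`, is unitary with plaquette radius `radIter d L m x ≥ 0`; for `m ≤ j` moreover
`twoLevelSmall·radIter d L m x ≤ 1` and `512(d+1)(d+4)L²·radIter d L m x ≤ 1`. [folklore] -/
theorem levelData [Nonempty n] {L : ℕ} (hL : 1 ≤ L) {j : ℕ} {W : Site d → Fin d → (Matrix n n ℂ)ˣ} {x : ℝ} (hWu : IsUnitaryCfg W)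
    (hx : 0 ≤ x) (hsm : LevelSmall d L j x) (hWx : SmallField W x) {m : ℕ} (hm : m ≤ j + 1) :
    IsUnitaryCfg (cavgIter L m W) ∧ 0 ≤ radIter d L m x ∧ SmallField (cavgIter L m W) (radIter d L m x)
      ∧ (m ≤ j → twoLevelSmall d L * radIter d L m x ≤ 1 ∧ 512 * (d + 1) * (d + 4) * (L : ℝ) ^ 2 * radIter d L m x ≤ 1) := by
  have htls : m ≤ j → twoLevelSmall d L * radIter d L m x ≤ 1 := by
    intro hmj
    have h := levelSmall_shift (d := d) (L := L) m (i := j - m) (x := x) (by rw [Nat.add_sub_cancel' hmj]; exact hsm)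
    exact h.two
  have h512 : m ≤ j → 512 * (d + 1) * (d + 4) * (L : ℝ) ^ 2 * radIter d L m x ≤ 1 := by
    intro hmj
    rcases m with _ | m
    · exact (step_small hL hWu hx (htls hmj) hWx).1
    · obtain ⟨hU, hr, hS⟩ := cavgIter_unitary_small hL m hWu hx (levelSmall_of_le (by omega) hsm) hWx
      exact (step_small hL hU hr (htls hmj) hS).1
  rcases m with _ | m
  · exact ⟨hWu, hx, hWx, fun hmj => ⟨htls hmj, h512 hmj⟩⟩
  · obtain ⟨hU, hr, hS⟩ := cavgIter_unitary_small hL m hWu hx (levelSmall_of_le (by omega) hsm) hWx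
    exact ⟨hU, hr, hS, fun hmj => ⟨htls hmj, h512 hmj⟩⟩

/-! ## §3 The straight double-bar tower in sup -/
/-- **THE DOUBLE-BAR TOWER IN SUP, PRODUCT FORM**: in the tower class with `LevelSmall d L j x`, for `‖Y‖ ≤ s` (`s ≥ 0`) and the summed
curvature line `curvSum d L (j+1) x ≤ (2∕3)·L`,
`‖QbarIter L (j+1) W Y z κ‖ ≤ L^{j+1}·(1 + 3·curvSum d L (j+1) x ∕ L)·s` (`Π_i (1 + curv_i∕L) ≤ 1 + 3Σ_i curv_i∕L` while the sum is
`≤ 2∕3·L`). [folklore] -/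
theorem norm_QbarIter_le_sup' [Nonempty n] {L : ℕ} (hL : 1 ≤ L) :
    ∀ (j : ℕ) {W : Site d → Fin d → (Matrix n n ℂ)ˣ} {x : ℝ}, IsUnitaryCfg W → 0 ≤ x → LevelSmall d L j x → SmallField W x →
    ∀ {Y : Site d → Fin d → (Matrix n n ℂ)} {s : ℝ}, 0 ≤ s → (∀ (z : Site d) (μ : Fin d), ‖Y z μ‖ ≤ s) →
    curvSum d L (j + 1) x ≤ 2 / 3 * L →
    ∀ (z : Site d) (κ : Fin d),
      ‖QbarIter L (j + 1) W Y z κ‖ ≤ (L : ℝ) ^ (j + 1) * (1 + 3 * curvSum d L (j + 1) x / L) * s := by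
  intro j
  induction j with
  | zero =>
      intro W x hWu hx hsm hWx Y s hs hY hA z κ
      have hL0 : (0 : ℝ) < L := by exact_mod_cast (by omega : 0 < L)
      obtain ⟨h512, -, -, -⟩ := step_small hL hWu hx hsm.two hWx
      have h := norm_Qbar_le_sup hL hWu hx h512 hWx Y hY z κ
      rw [QbarIter_one]
      have hcs : curvSum d L (0 + 1) x = curv d L x := by unfold curvSum; simp [radIter]
      rw [hcs]
      have hc0 := curv_nonneg (d := d) L hx
      calc ‖Qbar L W Y z κ‖ ≤ ((L : ℝ) + curv d L x) * s := h
        _ ≤ (L : ℝ) ^ (0 + 1) * (1 + 3 * curv d L x / L) * s := by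
            refine mul_le_mul_of_nonneg_right ?_ hs
            rw [zero_add, pow_one, mul_add, mul_one, mul_div_assoc', mul_div_cancel_left₀ _ hL0.ne']
            linarith
  | succ j ih =>
      intro W x hWu hx hsm hWx Y s hs hY hA z κ
      have hL0 : (0 : ℝ) < L := by exact_mod_cast (by omega : 0 < L)
      obtain ⟨h512, hU', hx', hS'⟩ := step_small hL hWu hx hsm.1 hWx
      -- one step: the first average, sup `(L + curv x)·s`
      have h1 : ∀ (z : Site d) (μ : Fin d), ‖Qbar L W Y z μ‖ ≤ ((L : ℝ) + curv d L x) * s :=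
        fun z μ => norm_Qbar_le_sup hL hWu hx h512 hWx Y hY z μ
      have hc0 := curv_nonneg (d := d) L hx
      have hs' : 0 ≤ ((L : ℝ) + curv d L x) * s := by positivity
      -- the remaining tower at the averaged background
      have hA' : curvSum d L (j + 1) (prop1Radius d L x) ≤ 2 / 3 * L := by
        rw [curvSum_succ] at hA; linarith
      have h := ih hU' hx' hsm.2 hS' hs' h1 hA' z κ
      rw [QbarIter_succ]
      refine h.trans ?_
      rw [curvSum_succ L (j + 1) x]
      set A' := curvSum d L (j + 1) (prop1Radius d L x) with hA'def
      set c := curv d L x with hcdef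
      have hA'0 : 0 ≤ A' := curvSum_nonneg L (j + 1) hx'
      have hB' : 3 * A' / L ≤ 2 := by
        rw [div_le_iff₀ hL0]; rw [curvSum_succ] at hA; linarith
      have hB'0 : 0 ≤ 3 * A' / L := by positivity
      -- `(1 + B')(L + c) ≤ L(1 + 3(c + A')/L)`
      have key : (1 + 3 * A' / L) * ((L : ℝ) + c) ≤ (L : ℝ) * (1 + 3 * (c + A') / L) := by
        have e1 : (L : ℝ) * (1 + 3 * (c + A') / L) = L + 3 * c + 3 * A' := by field_simp; ring
        have e2 : (1 + 3 * A' / L) * ((L : ℝ) + c) = L + 3 * A' + c + (3 * A' / L) * c := by field_simp; ring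
        rw [e1, e2]
        nlinarith
      calc (L : ℝ) ^ (j + 1) * (1 + 3 * A' / L) * (((L : ℝ) + c) * s)
          = (L : ℝ) ^ (j + 1) * ((1 + 3 * A' / L) * ((L : ℝ) + c)) * s := by ring
        _ ≤ (L : ℝ) ^ (j + 1) * ((L : ℝ) * (1 + 3 * (c + A') / L)) * s :=
            mul_le_mul_of_nonneg_right (mul_le_mul_of_nonneg_left key (by positivity)) hs
        _ = (L : ℝ) ^ (j + 1 + 1) * (1 + 3 * (c + A') / L) * s := by ring

/-- **THE DOUBLE-BAR TOWER IN SUP**: under the summed curvature line `curvSum d L (j+1) x ≤ (2∕3)·L`,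
`‖QbarIter L (j+1) W Y z κ‖ ≤ 3·L^{j+1}·s`. [folklore] -/
theorem norm_QbarIter_le_sup [Nonempty n] {L : ℕ} (hL : 1 ≤ L) (j : ℕ) {W : Site d → Fin d → (Matrix n n ℂ)ˣ} {x : ℝ}
    (hWu : IsUnitaryCfg W) (hx : 0 ≤ x) (hsm : LevelSmall d L j x) (hWx : SmallField W x)
    {Y : Site d → Fin d → (Matrix n n ℂ)} {s : ℝ} (hs : 0 ≤ s) (hY : ∀ (z : Site d) (μ : Fin d), ‖Y z μ‖ ≤ s)
    (hA : curvSum d L (j + 1) x ≤ 2 / 3 * L) (z : Site d) (κ : Fin d) :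
    ‖QbarIter L (j + 1) W Y z κ‖ ≤ 3 * (L : ℝ) ^ (j + 1) * s := by
  have hL0 : (0 : ℝ) < L := by exact_mod_cast (by omega : 0 < L)
  have h := norm_QbarIter_le_sup' hL j hWu hx hsm hWx hs hY hA z κ
  have hB : 3 * curvSum d L (j + 1) x / L ≤ 2 := by rw [div_le_iff₀ hL0]; linarith
  refine h.trans ?_
  have hp : 0 ≤ (L : ℝ) ^ (j + 1) := by positivity
  nlinarith [mul_nonneg hp hs]

/-- The level-`m` double-bar field in sup, for every `m ≤ j + 1` (the case `m = 0` is `Y` itself). [folklore] -/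
theorem norm_QbarIter_le_sup_of_le [Nonempty n] {L : ℕ} (hL : 1 ≤ L) {j : ℕ} {W : Site d → Fin d → (Matrix n n ℂ)ˣ} {x : ℝ}
    (hWu : IsUnitaryCfg W) (hx : 0 ≤ x) (hsm : LevelSmall d L j x) (hWx : SmallField W x)
    {Y : Site d → Fin d → (Matrix n n ℂ)} {s : ℝ} (hs : 0 ≤ s) (hY : ∀ (z : Site d) (μ : Fin d), ‖Y z μ‖ ≤ s)
    (hA : curvSum d L (j + 1) x ≤ 2 / 3 * L) {m : ℕ} (hm : m ≤ j + 1) (z : Site d) (κ : Fin d) :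
    ‖QbarIter L m W Y z κ‖ ≤ 3 * (L : ℝ) ^ m * s := by
  rcases m with _ | m
  · rw [QbarIter_zero, pow_zero, mul_one]
    linarith [hY z κ]
  · have hsm' : LevelSmall d L m x := levelSmall_of_le (by omega) hsm
    have hA' : curvSum d L (m + 1) x ≤ 2 / 3 * L := (curvSum_mono L hm hx).trans hA
    exact norm_QbarIter_le_sup hL m hWu hx hsm' hWx hs hY hA' z κ

/-! ## §4 The accumulated frames in sup -/
omit [Fintype n] [DecidableEq n] in
/-- The geometric sum: `Σ_{m<k} L^m ≤ 2·L^k ∕ L` hence `≤ L^k` … precisely `(L − 1)·Σ_{m<k} L^m ≤ L^k` (`L ≥ 1`). [folklore] -/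
theorem geom_sum_mul_le (L : ℕ) (k : ℕ) : ((L : ℝ) - 1) * ∑ m ∈ range k, (L : ℝ) ^ m ≤ (L : ℝ) ^ k := by
  have h : ((L : ℝ) - 1) * ∑ m ∈ range k, (L : ℝ) ^ m = (L : ℝ) ^ k - 1 := by
    have := geom_sum_mul (x := (L : ℝ)) k
    linarith [this]
  rw [h]; linarith

/-- **THE ACCUMULATED FRAME GENERATOR IN SUP** (`2 ≤ L`): in the tower class with the curvature line,
`‖framePotW L (j+1) W Y z‖ ≤ 6d·L^{j+1}·s` (closed form `framePotW_eq_sum`, one frame `≤ dL·(3L^m s)`, `Σ_{m≤j} L^m ≤ 2L^j`). [folklore] -/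
theorem norm_framePotW_le_sup [Nonempty n] {L : ℕ} (hL : 2 ≤ L) (j : ℕ) {W : Site d → Fin d → (Matrix n n ℂ)ˣ} {x : ℝ}
    (hWu : IsUnitaryCfg W) (hx : 0 ≤ x) (hsm : LevelSmall d L j x) (hWx : SmallField W x)
    {Y : Site d → Fin d → (Matrix n n ℂ)} {s : ℝ} (hs : 0 ≤ s) (hY : ∀ (z : Site d) (μ : Fin d), ‖Y z μ‖ ≤ s)
    (hA : curvSum d L (j + 1) x ≤ 2 / 3 * L) (z : Site d) :
    ‖framePotW L (j + 1) W Y z‖ ≤ 6 * (d : ℝ) * (L : ℝ) ^ (j + 1) * s := by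
  have hL1 : 1 ≤ L := by omega
  have hL0 : (0 : ℝ) < L := by exact_mod_cast (by omega : 0 < L)
  rw [framePotW_eq_sum]
  -- each term: `‖Fbar (W_m) (QbarIter m) _‖ ≤ dL · 3L^m s`
  have hterm : ∀ m ∈ range (j + 1),
      ‖Fbar L (cavgIter L m W) (QbarIter L m W Y) (((L : ℤ) ^ (j + 1 - 1 - m)) • z)‖ ≤ ((d : ℝ) * L) * (3 * (L : ℝ) ^ m * s) := by
    intro m hm
    have hmj : m ≤ j + 1 := by have := Finset.mem_range.mp hm; omega
    obtain ⟨hU, -, -, -⟩ := levelData hL1 hWu hx hsm hWx hmj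
    exact norm_Fbar_le_sup hL1 hU _ (by positivity) (fun x' μ => norm_QbarIter_le_sup_of_le hL1 hWu hx hsm hWx hs hY hA hmj x' μ) _
  calc ‖∑ m ∈ range (j + 1), Fbar L (cavgIter L m W) (QbarIter L m W Y) (((L : ℤ) ^ (j + 1 - 1 - m)) • z)‖
      ≤ ∑ m ∈ range (j + 1), ‖Fbar L (cavgIter L m W) (QbarIter L m W Y) (((L : ℤ) ^ (j + 1 - 1 - m)) • z)‖ := norm_sum_le _ _
    _ ≤ ∑ m ∈ range (j + 1), ((d : ℝ) * L) * (3 * (L : ℝ) ^ m * s) := Finset.sum_le_sum hterm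
    _ = 3 * (d : ℝ) * s * ((L : ℝ) * ∑ m ∈ range (j + 1), (L : ℝ) ^ m) := by
        simp only [Finset.mul_sum]
        exact Finset.sum_congr rfl fun m _ => by ring
    _ ≤ 3 * (d : ℝ) * s * (2 * (L : ℝ) ^ (j + 1)) := by
        refine mul_le_mul_of_nonneg_left ?_ (by positivity)
        -- `L·Σ_{m≤j} L^m ≤ 2((L−1)Σ) ≤ 2L^{j+1}` for `L ≥ 2`
        have hg := geom_sum_mul_le L (j + 1)
        have hS0 : 0 ≤ ∑ m ∈ range (j + 1), (L : ℝ) ^ m := Finset.sum_nonneg fun _ _ => by positivity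
        have hL2 : (2 : ℝ) ≤ L := by exact_mod_cast hL
        nlinarith
    _ = 6 * (d : ℝ) * (L : ℝ) ^ (j + 1) * s := by ring

/-! ## §5 The linearised k-fold average in sup -/
/-- **THE SUP LETTER OF THE LINEARISED k-FOLD AVERAGE** (`2 ≤ L`, tower class of period `tower L N (j+1)`, skew periodic `Y` with
`‖Y‖ ≤ s`, curvature line `curvSum d L (j+1) x ≤ (2∕3)·L`):
`‖dirIter L (j+1) W Y z κ‖ ≤ (3 + 12d)·L^{j+1}·s` — k-FREE.  (Structure theorem `dirIter = QbarIter + gaugeDir (cavgIter) (framePotW)` BY NAME;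
`3` from the straight tower, `2·6d` from the coarse gauge direction of the accumulated frames.) [folklore] -/
theorem norm_dirIter_le_sup [Nonempty n] {L N : ℕ} [NeZero N] (hL : 2 ≤ L) (j : ℕ) {W : Site d → Fin d → (Matrix n n ℂ)ˣ} {x : ℝ}
    (hWu : IsUnitaryCfg W) (hWP : IsPeriodicCfg W ((tower L N (j + 1) : ℕ) : ℤ)) (hx : 0 ≤ x) (hsm : LevelSmall d L j x)
    (hWx : SmallField W x) {Y : Site d → Fin d → (Matrix n n ℂ)} (hYs : IsSkewDir Y) (hYP : IsPeriodicDir Y ((tower L N (j + 1) : ℕ) : ℤ))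
    {s : ℝ} (hs : 0 ≤ s) (hY : ∀ (z : Site d) (μ : Fin d), ‖Y z μ‖ ≤ s) (hA : curvSum d L (j + 1) x ≤ 2 / 3 * L)
    (z : Site d) (κ : Fin d) :
    ‖dirIter L (j + 1) W Y z κ‖ ≤ (3 + 12 * (d : ℝ)) * (L : ℝ) ^ (j + 1) * s := by
  have hL1 : 1 ≤ L := by omega
  rw [dirIter_eq_QbarIter_add_gaugeDir (M := N) hL1 j hWu hWP hx hsm hWx hYs hYP]
  obtain ⟨hU, -, -, -⟩ := levelData hL1 hWu hx hsm hWx (m := j + 1) le_rfl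
  have h1 := norm_QbarIter_le_sup hL1 j hWu hx hsm hWx hs hY hA z κ
  have h2 := norm_gaugeDir_le_sup hU (fun z' => norm_framePotW_le_sup hL j hWu hx hsm hWx hs hY hA z') z κ
  calc ‖QbarIter L (j + 1) W Y z κ + gaugeDir (cavgIter L (j + 1) W) (framePotW L (j + 1) W Y) z κ‖
      ≤ ‖QbarIter L (j + 1) W Y z κ‖ + ‖gaugeDir (cavgIter L (j + 1) W) (framePotW L (j + 1) W Y) z κ‖ := norm_add_le _ _
    _ ≤ 3 * (L : ℝ) ^ (j + 1) * s + 2 * (6 * (d : ℝ) * (L : ℝ) ^ (j + 1) * s) := add_le_add h1 h2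
    _ = (3 + 12 * (d : ℝ)) * (L : ℝ) ^ (j + 1) * s := by ring

/-! ## §6 The curvature line in the θ-letter -/
omit [Fintype n] [DecidableEq n] in
/-- **THE SUMMED CURVATURE LETTER IN THE θ-LETTER** (`2 ≤ L`, `x ≥ 0`, `LevelSmall d L j x`): every level radius is at most
`(17∕16)·(L²)^i·x` (NE3-R2's `iterate_prop1Radius_le_of_levelSmall`), so `curvSum d L (j+1) x ≤ (17∕12)·curv d L ((L²)^j·x)`
(`Σ_{i≤j}(L²)^i ≤ (4∕3)(L²)^j`). [folklore] -/
theorem curvSum_le_of_levelSmall {L : ℕ} (hL : 2 ≤ L) (j : ℕ) {x : ℝ} (hx : 0 ≤ x) (hsm : LevelSmall d L j x) :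
    curvSum d L (j + 1) x ≤ 17 / 12 * curv d L (((L : ℝ) ^ 2) ^ j * x) := by
  have hL1 : 1 ≤ L := by omega
  have hL2 : (2 : ℝ) ≤ L := by exact_mod_cast hL
  have hq : (4 : ℝ) ≤ (L : ℝ) ^ 2 := by nlinarith
  -- each term
  have hterm : ∀ i ∈ range (j + 1), curv d L (radIter d L i x) ≤ 17 / 16 * (((L : ℝ) ^ 2) ^ i * curv d L x) := by
    intro i hi
    have hij : i ≤ j := by have := Finset.mem_range.mp hi; omega
    have hr : radIter d L i x ≤ 17 / 16 * (((L : ℝ) ^ 2) ^ i * x) := by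
      rw [radIter_eq_iterate]
      exact iterate_prop1Radius_le_of_levelSmall hL i hx (levelSmall_of_le hij hsm)
    calc curv d L (radIter d L i x) ≤ curv d L (17 / 16 * (((L : ℝ) ^ 2) ^ i * x)) := curv_mono L hr
      _ = 17 / 16 * (((L : ℝ) ^ 2) ^ i * curv d L x) := by rw [curv_mul, curv_mul]
  -- the geometric sum in `q = L²`
  have hgeom : ∑ i ∈ range (j + 1), ((L : ℝ) ^ 2) ^ i ≤ 4 / 3 * ((L : ℝ) ^ 2) ^ j := by
    have hg := geom_sum_mul (x := (L : ℝ) ^ 2) (j + 1)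
    -- `(q-1)Σ = q^{j+1} - 1 ≤ q·q^j`, `q - 1 ≥ 3q/4`
    have hS0 : 0 ≤ ∑ i ∈ range (j + 1), ((L : ℝ) ^ 2) ^ i := Finset.sum_nonneg fun _ _ => by positivity
    have hqj : 0 ≤ ((L : ℝ) ^ 2) ^ j := by positivity
    have e : ((L : ℝ) ^ 2) ^ (j + 1) = (L : ℝ) ^ 2 * ((L : ℝ) ^ 2) ^ j := by ring
    nlinarith
  have hc0 := curv_nonneg (d := d) L hx
  calc curvSum d L (j + 1) x = ∑ i ∈ range (j + 1), curv d L (radIter d L i x) := rfl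
    _ ≤ ∑ i ∈ range (j + 1), 17 / 16 * (((L : ℝ) ^ 2) ^ i * curv d L x) := Finset.sum_le_sum hterm
    _ = 17 / 16 * curv d L x * ∑ i ∈ range (j + 1), ((L : ℝ) ^ 2) ^ i := by
        rw [Finset.mul_sum]; exact Finset.sum_congr rfl fun i _ => by ring
    _ ≤ 17 / 16 * curv d L x * (4 / 3 * ((L : ℝ) ^ 2) ^ j) := mul_le_mul_of_nonneg_left hgeom (by positivity)
    _ = 17 / 12 * curv d L (((L : ℝ) ^ 2) ^ j * x) := by rw [curv_mul]; ring

end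

end Summit.QuantumFields.BalabanUV.T4Continuum.NE3LinearisedAverageSup
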